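import Summits.Ventures.PercRepro.C026C028Defs

/-!
# THEOREM T3 in the state algebra: C-028 on the doubly-symmetric triangle (p6, gen 15;
mine-3 MINE3-GLUING v10 §15 (c))

mine-3's C-028 state of a marked multigraph is `(Z, Mₐ, M_b, K)`; an `a ↔ b`-symmetric state is
`(z, a, a, k)`, its C-028 slack `Δ = Y_a − d = a(1 + 2k) − z(2 + k)`, and C-028 reads `Δ ≥ 0`, i.e.
`k ≥ (2x − 1)/(2 − x)` with `x = z/a` (`symSlack_nonneg_iff`).  The state algebra: the series edge of
weight `r` at the probe (`seriesSym`, `Δ(S_r σ) = r·Δ(σ)`), the gluing (`glueSym`, coordinatewise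
products).  The doubly-symmetric triangle — a bare probe joined by edges of weight `r` to two copies of
`B`, joined to each other by an edge of weight `p` — has the state
`M(p) = (1 − p)·(S_r B ⊙ S_r B) + p·S_{r(2−r)}(B ⊙ B)` (the (N)-step at the edge `v₁v₂`), and
**`t3_slack_nonneg`: `Δ(M(p)) ≥ 0` for every `r, p ∈ [0, 1]`** — C-028 on the first graphs with a cycle
in `G − a − b`.  Proof as in §15: `Δ(M(p)) = (1 − p)Δ(M₀) + pΔ(M₁) − p(1 − p)π_K π_n̄`
(`triangle_slack_eq`), `Δ(M₀) ≥ 0` by LEMMA G2 (`c028Phi_mul_le`), `Δ(M₁) = r(2 − r)Δ(B ⊙ B)` and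
LEMMA G2-QUANT-DIAG (`g2quant_diag`, proved here: the band's `0 ≤ v ≤ 1` is not needed): `Δ(B ⊙ B) ≥ 2k(1 − k)(a − z)²`, whence
`Δ(M₁) − π_K π_n̄ ≥ 2r²k(1 − k)(a − z)²(1 + 2r − 2r²) ≥ 0`.
-/

namespace PercRepro

/-! ### LEMMA G2-QUANT-DIAG (mine-3 §15 (c) (5)): with `u = 1 − x`, `v = 1 − k`,
`g₂(u, v) = (1 + u)² v² − 2(1 + 2u) v + 3u(2 − u) ≥ 0` on `0 ≤ u ≤ 1`, `(1 + u)v ≤ 3u` -/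

/-- The G2-QUANT-DIAG polynomial. -/
noncomputable def g2quant (u v : ℝ) : ℝ := (1 + u) ^ 2 * v ^ 2 - 2 * (1 + 2 * u) * v + 3 * u * (2 - u)

/-- `(1 + u)·g₂` in the band coordinate `w = 3u − (1 + u)v`. -/
theorem g2quant_mul_eq (u v : ℝ) :
    (1 + u) * g2quant u v =
      6 * u ^ 3 + 2 * (3 * u - (1 + u) * v) * (1 - u - 3 * u ^ 2) +
        (1 + u) * (3 * u - (1 + u) * v) ^ 2 := by
  unfold g2quant
  ring

/-- `(1 + u)²·g₂` as a square plus mine-3's interior-vertex constant. -/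
theorem g2quant_sq_eq (u v : ℝ) :
    (1 + u) ^ 2 * g2quant u v =
      ((1 + u) * (3 * u - (1 + u) * v) + (1 - u - 3 * u ^ 2)) ^ 2 +
        (-3 * u ^ 4 + 5 * u ^ 2 + 2 * u - 1) := by
  unfold g2quant
  ring

/-- **LEMMA G2-QUANT-DIAG**: `g₂(u, v) ≥ 0` for `0 ≤ u ≤ 1` and `(1 + u)v ≤ 3u` — the constraints
`0 ≤ v ≤ 1` of the band are not needed. -/
theorem g2quant_diag {u v : ℝ} (hu0 : 0 ≤ u) (hu1 : u ≤ 1) (hband : (1 + u) * v ≤ 3 * u) :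
    0 ≤ g2quant u v := by
  have h1u : 0 < 1 + u := by linarith
  have hw : 0 ≤ 3 * u - (1 + u) * v := by linarith
  by_cases hc : 0 ≤ 1 - u - 3 * u ^ 2
  · have key := g2quant_mul_eq u v
    have : 0 ≤ (1 + u) * g2quant u v := by
      rw [key]
      have t1 : 0 ≤ 6 * u ^ 3 := by positivity
      have t2 : 0 ≤ 2 * (3 * u - (1 + u) * v) * (1 - u - 3 * u ^ 2) :=
        mul_nonneg (mul_nonneg (by norm_num) hw) hc
      have t3 : 0 ≤ (1 + u) * (3 * u - (1 + u) * v) ^ 2 := mul_nonneg h1u.le (sq_nonneg _)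
      linarith
    exact (mul_nonneg_iff_of_pos_left h1u).1 this
  · have hc' : 1 ≤ u + 3 * u ^ 2 := by linarith
    have key := g2quant_sq_eq u v
    have hP : 0 ≤ -3 * u ^ 4 + 5 * u ^ 2 + 2 * u - 1 := by
      have hu4 : u ^ 4 ≤ u ^ 2 := by
        have : u ^ 2 ≤ 1 := by nlinarith
        nlinarith [sq_nonneg u]
      nlinarith [mul_nonneg hu0 (sub_nonneg.2 hu1)]
    have : 0 ≤ (1 + u) ^ 2 * g2quant u v := by
      rw [key]
      have := sq_nonneg ((1 + u) * (3 * u - (1 + u) * v) + (1 - u - 3 * u ^ 2))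
      linarith
    exact (mul_nonneg_iff_of_pos_left (by positivity)).1 this

/-- The boundary value at `v = 3u/(1 + u)`: `6u³/(1 + u)`. -/
theorem g2quant_band_boundary {u : ℝ} (hu : 0 ≤ u) :
    g2quant u (3 * u / (1 + u)) = 6 * u ^ 3 / (1 + u) := by
  have h1u : (1 + u) ≠ 0 := by positivity
  unfold g2quant
  field_simp
  ring

/-- The boundary value at `v = 1`: `1 − 2(1 − u)²`. -/
theorem g2quant_one (u : ℝ) : g2quant u 1 = 1 - 2 * (1 - u) ^ 2 := by
  unfold g2quant
  ring

/-! ### Symmetric states -/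

/-- An `a ↔ b`-symmetric C-028 state: `Z = z`, `Mₐ = M_b = a`, `K = k`. -/
structure SymState where
  /-- `Z = P(a|b|c)` -/
  z : ℝ
  /-- `Mₐ = M_b = P(b iso) = P(a iso)` -/
  a : ℝ
  /-- `K = P(c iso)` -/
  k : ℝ

namespace SymState

/-- The C-028 slack `Δ = Y_a − d = a(1 + 2k) − z(2 + k)`. -/
def slack (σ : SymState) : ℝ := σ.a * (1 + 2 * σ.k) - σ.z * (2 + σ.k)

/-- `n̄ = P(a ↮ b) = 2a − z`. -/
def nbar (σ : SymState) : ℝ := 2 * σ.a - σ.z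

/-- The series edge of weight `r` at the probe. -/
def series (r : ℝ) (σ : SymState) : SymState :=
  ⟨2 * σ.a - σ.z - r * (2 * σ.a - 2 * σ.z), 2 * σ.a - σ.z - r * (σ.a - σ.z), 1 - r * (1 - σ.k)⟩

/-- The gluing of two symmetric states at the three terminals (coordinatewise products). -/
def glue (σ τ : SymState) : SymState := ⟨σ.z * τ.z, σ.a * τ.a, σ.k * τ.k⟩

/-- The affine combination of two states (the law is linear). -/
def mixS (p : ℝ) (σ τ : SymState) : SymState :=
  ⟨(1 - p) * σ.z + p * τ.z, (1 - p) * σ.a + p * τ.a, (1 - p) * σ.k + p * τ.k⟩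

/-- `Δ` is affine plus `K·n̄`: `Δ = (a − 2z) + k·n̄`. -/
theorem slack_eq (σ : SymState) : σ.slack = (σ.a - 2 * σ.z) + σ.k * σ.nbar := by
  unfold slack nbar; ring

/-- The slack of a series edge scales by its weight. -/
theorem slack_series (r : ℝ) (σ : SymState) : (series r σ).slack = r * σ.slack := by
  unfold slack series; ring

/-- The slack of a mixture: the (N)-step identity
`Δ(mix) = (1 − p)Δ(σ) + pΔ(τ) − p(1 − p)·(K(σ) − K(τ))·(n̄(σ) − n̄(τ))`. -/
theorem slack_mix (p : ℝ) (σ τ : SymState) :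
    (mixS p σ τ).slack =
      (1 - p) * σ.slack + p * τ.slack - p * (1 - p) * ((σ.k - τ.k) * (σ.nbar - τ.nbar)) := by
  unfold slack mixS nbar; ring

/-- The slack of a self-gluing: `Δ(B ⊙ B) = a²(1 + 2k²) − z²(2 + k²)`. -/
theorem slack_glue_self (σ : SymState) :
    (glue σ σ).slack = σ.a ^ 2 * (1 + 2 * σ.k ^ 2) - σ.z ^ 2 * (2 + σ.k ^ 2) := by
  unfold slack glue; ring

/-- **C-028 in `Φ`-form for symmetric states**: for `0 < z ≤ a`,
`Δ ≥ 0 ↔ Φ(z/a, z/a) ≤ k` (the rows form `c028_rows_iff_phi` with `Mₐ = M_b = a`). -/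
theorem slack_nonneg_iff_phi (σ : SymState) (hz : 0 < σ.z) (hza : σ.z ≤ σ.a) :
    0 ≤ σ.slack ↔ c028Phi (σ.z / σ.a) (σ.z / σ.a) ≤ σ.k := by
  have h := c028_rows_iff_phi (Z := σ.z) (Ma := σ.a) (Mb := σ.a) (K := σ.k) hz hza hza
  have hsq : Real.sqrt ((σ.a - σ.z) * (σ.a - σ.z)) = σ.a - σ.z := by
    rw [show (σ.a - σ.z) * (σ.a - σ.z) = (σ.a - σ.z) ^ 2 by ring]
    exact Real.sqrt_sq (by linarith)
  rw [hsq] at h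
  unfold slack c028Phi at *
  constructor
  · intro hs
    exact h.1 (by linarith)
  · intro hk
    have := h.2 hk
    linarith

/-- **LEMMA G2-QUANT-DIAG in state form**: for a symmetric state with `0 ≤ z ≤ a`, `0 < a`, `k ≤ 1` and
C-028, `Δ(B ⊙ B) ≥ 2k(1 − k)(a − z)²`. -/
theorem slack_glue_self_ge (σ : SymState) (hz0 : 0 ≤ σ.z) (hza : σ.z ≤ σ.a) (ha : 0 < σ.a)
    (hC : 0 ≤ σ.slack) :
    2 * σ.k * (1 - σ.k) * (σ.a - σ.z) ^ 2 ≤ (glue σ σ).slack := by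
  set u := 1 - σ.z / σ.a with hu
  set v := 1 - σ.k with hv
  have hu0 : 0 ≤ u := by
    rw [hu, sub_nonneg, div_le_one ha]; exact hza
  have hu1 : u ≤ 1 := by
    rw [hu]; have : 0 ≤ σ.z / σ.a := div_nonneg hz0 ha.le; linarith
  -- the band: `(1 + u) v ≤ 3u` is C-028 `Δ ≥ 0` divided by `a`
  have hband : (1 + u) * v ≤ 3 * u := by
    rw [hu, hv]
    have hC' : 0 ≤ σ.slack / σ.a := div_nonneg hC ha.le
    unfold slack at hC'
    have e : (1 + (1 - σ.z / σ.a)) * (1 - σ.k) = 3 * (1 - σ.z / σ.a) -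
        (σ.a * (1 + 2 * σ.k) - σ.z * (2 + σ.k)) / σ.a := by
      field_simp
      ring
    rw [e]
    linarith
  have hg := g2quant_diag hu0 hu1 hband
  -- `Δ(B ⊙ B) − 2k(1 − k)(a − z)² = a²·g₂(u, v)`
  have e2 : (glue σ σ).slack - 2 * σ.k * (1 - σ.k) * (σ.a - σ.z) ^ 2 = σ.a ^ 2 * g2quant u v := by
    rw [slack_glue_self, hu, hv]
    unfold g2quant
    field_simp
    ring
  have : 0 ≤ σ.a ^ 2 * g2quant u v := mul_nonneg (sq_nonneg _) hg
  linarith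

end SymState

/-! ### The doubly-symmetric triangle -/

/-- The state of the doubly-symmetric triangle: a bare probe joined by edges of weight `r` to two copies
of `B`, joined to each other by an edge of weight `p` — the (N)-step at `v₁v₂`:
`(1 − p)·(S_r B ⊙ S_r B) + p·S_{r(2−r)}(B ⊙ B)`. -/
def triangleState (r p : ℝ) (B : SymState) : SymState :=
  SymState.mixS p (SymState.glue (SymState.series r B) (SymState.series r B))
    (SymState.series (r * (2 - r)) (SymState.glue B B))

/-- The pivotal differences of the edge `v₁v₂`: `π_K = 2r(1 − r)k(1 − k)`, `π_n̄ = 2(1 − r²)(a − z)²`. -/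
theorem triangle_pivots (r : ℝ) (B : SymState) :
    (SymState.glue (SymState.series r B) (SymState.series r B)).k -
        (SymState.series (r * (2 - r)) (SymState.glue B B)).k =
        2 * r * (1 - r) * B.k * (1 - B.k) ∧
      (SymState.glue (SymState.series r B) (SymState.series r B)).nbar -
        (SymState.series (r * (2 - r)) (SymState.glue B B)).nbar =
        2 * (1 - r ^ 2) * (B.a - B.z) ^ 2 := by
  constructor <;> (simp only [SymState.glue, SymState.series, SymState.nbar]; ring)

/-- The (N)-step identity for the triangle:
`Δ(M(p)) = (1 − p)Δ(M₀) + pΔ(M₁) − p(1 − p)·π_K·π_n̄`. -/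
theorem triangle_slack_eq (r p : ℝ) (B : SymState) :
    (triangleState r p B).slack =
      (1 - p) * (SymState.glue (SymState.series r B) (SymState.series r B)).slack +
        p * (r * (2 - r) * (SymState.glue B B).slack) -
        p * (1 - p) * ((2 * r * (1 - r) * B.k * (1 - B.k)) * (2 * (1 - r ^ 2) * (B.a - B.z) ^ 2)) := by
  unfold triangleState
  rw [SymState.slack_mix, SymState.slack_series, (triangle_pivots r B).1, (triangle_pivots r B).2]

/-- The slack of the deletion minor `M₀ = S_r B ⊙ S_r B` is nonnegative: LEMMA G2 for the gluing of
two copies of the series state (the forest-class member). -/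
theorem slack_glue_series_nonneg (r : ℝ) (hr0 : 0 ≤ r) (hr1 : r ≤ 1) (B : SymState)
    (hz0 : 0 ≤ B.z) (hza : B.z ≤ B.a) (hk0 : 0 ≤ B.k) (hC : 0 ≤ B.slack) :
    0 ≤ (SymState.glue (SymState.series r B) (SymState.series r B)).slack := by
  set σ := SymState.series r B with hσ
  have hσz : 0 ≤ σ.z := by
    rw [hσ]; simp only [SymState.series]; nlinarith
  have hσa : σ.z ≤ σ.a := by
    rw [hσ]; simp only [SymState.series]; nlinarith
  have hσk0 : 0 ≤ σ.k := by
    rw [hσ]; simp only [SymState.series]; nlinarith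
  have hσC : 0 ≤ σ.slack := by rw [hσ, SymState.slack_series]; exact mul_nonneg hr0 hC
  -- the degenerate case `z = 0`: the glued slack is `a²(1 + 2k²) ≥ 0`
  rcases hσz.lt_or_eq with hzpos | hzzero
  · have hσa0 : 0 < σ.a := lt_of_lt_of_le hzpos hσa
    have hx0 : 0 ≤ σ.z / σ.a := div_nonneg hzpos.le hσa0.le
    have hx1 : σ.z / σ.a ≤ 1 := by rw [div_le_one hσa0]; exact hσa
    have hphi := (SymState.slack_nonneg_iff_phi σ hzpos hσa).1 hσC
    have hG2 := c028Phi_mul_le hx0 hx1 hx0 hx1 hx0 hx1 hx0 hx1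
    have hglue : (SymState.glue σ σ).slack ≥ 0 := by
      have hzz : 0 < (SymState.glue σ σ).z := by simp only [SymState.glue]; positivity
      have hza' : (SymState.glue σ σ).z ≤ (SymState.glue σ σ).a := by
        simp only [SymState.glue]; exact mul_le_mul hσa hσa hzpos.le hσa0.le
      rw [ge_iff_le, SymState.slack_nonneg_iff_phi _ hzz hza']
      have e : (SymState.glue σ σ).z / (SymState.glue σ σ).a = σ.z / σ.a * (σ.z / σ.a) := by
        simp only [SymState.glue]; rw [div_mul_div_comm]
      rw [e]
      refine le_trans hG2 ?_
      have hm : max (c028Phi (σ.z / σ.a) (σ.z / σ.a)) 0 ≤ σ.k := max_le hphi hσk0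
      calc max (c028Phi (σ.z / σ.a) (σ.z / σ.a)) 0 * max (c028Phi (σ.z / σ.a) (σ.z / σ.a)) 0
          ≤ σ.k * σ.k := mul_le_mul hm hm (le_max_right _ _) hσk0
        _ = (SymState.glue σ σ).k := by simp only [SymState.glue]
    exact hglue
  · rw [SymState.slack_glue_self, ← hzzero]
    nlinarith [sq_nonneg σ.a, sq_nonneg σ.k]

/-- **THEOREM T3 (state form)**: for a symmetric state `B` with `0 ≤ z ≤ a`, `0 < a`, `0 ≤ k ≤ 1` and
C-028 (`Δ(B) ≥ 0`), the doubly-symmetric triangle satisfies C-028 at every `r, p ∈ [0, 1]`. -/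
theorem t3_slack_nonneg (r p : ℝ) (hr0 : 0 ≤ r) (hr1 : r ≤ 1) (hp0 : 0 ≤ p) (hp1 : p ≤ 1)
    (B : SymState) (hz0 : 0 ≤ B.z) (hza : B.z ≤ B.a) (ha : 0 < B.a) (hk0 : 0 ≤ B.k) (hk1 : B.k ≤ 1)
    (hC : 0 ≤ B.slack) : 0 ≤ (triangleState r p B).slack := by
  rw [triangle_slack_eq]
  have h0 := slack_glue_series_nonneg r hr0 hr1 B hz0 hza hk0 hC
  have hQ := SymState.slack_glue_self_ge B hz0 hza ha hC
  -- `Δ(M₁) − π_K π_n̄ ≥ 2r²k(1 − k)(a − z)²(1 + 2r − 2r²) ≥ 0`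
  have hkk : 0 ≤ B.k * (1 - B.k) := mul_nonneg hk0 (by linarith)
  have hY : 0 ≤ (B.a - B.z) ^ 2 := sq_nonneg _
  have hpos : 0 ≤ 1 + 2 * r - 2 * r ^ 2 := by nlinarith
  have hkey : (2 * r * (1 - r) * B.k * (1 - B.k)) * (2 * (1 - r ^ 2) * (B.a - B.z) ^ 2) ≤
      r * (2 - r) * (SymState.glue B B).slack := by
    have h1 : r * (2 - r) * (2 * B.k * (1 - B.k) * (B.a - B.z) ^ 2) ≤
        r * (2 - r) * (SymState.glue B B).slack :=
      mul_le_mul_of_nonneg_left hQ (by nlinarith)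
    have h2 : (2 * r * (1 - r) * B.k * (1 - B.k)) * (2 * (1 - r ^ 2) * (B.a - B.z) ^ 2) ≤
        r * (2 - r) * (2 * B.k * (1 - B.k) * (B.a - B.z) ^ 2) := by
      have e : r * (2 - r) * (2 * B.k * (1 - B.k) * (B.a - B.z) ^ 2) -
          (2 * r * (1 - r) * B.k * (1 - B.k)) * (2 * (1 - r ^ 2) * (B.a - B.z) ^ 2) =
          2 * r ^ 2 * (B.k * (1 - B.k)) * (B.a - B.z) ^ 2 * (1 + 2 * r - 2 * r ^ 2) := by ring
      have : 0 ≤ 2 * r ^ 2 * (B.k * (1 - B.k)) * (B.a - B.z) ^ 2 * (1 + 2 * r - 2 * r ^ 2) := by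
        positivity
      linarith
    exact le_trans h2 h1
  have hp1' : 0 ≤ 1 - p := by linarith
  have hπ : 0 ≤ (2 * r * (1 - r) * B.k * (1 - B.k)) * (2 * (1 - r ^ 2) * (B.a - B.z) ^ 2) := by
    have h1r : 0 ≤ 1 - r := by linarith
    have h1r2 : 0 ≤ 1 - r ^ 2 := by nlinarith
    have : 0 ≤ 1 - B.k := by linarith
    positivity
  have t1 := mul_nonneg hp1' h0
  have t2 := mul_nonneg hp0 (sub_nonneg.2 hkey)
  have t3 := mul_nonneg (mul_nonneg hp0 hp0) hπ
  nlinarith [t1, t2, t3]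

end PercRepro
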